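import Summits.KontsevichZagierPeriods.KontsevichZagierPeriods.Theorems.SymplecticScissorsVolumeFormOffPlaneCornerCut

/-!
# `VolumeFormOffPlane` (stmt-KontsevichZagierPeriods-14935) — line `Sketch`,
stub `stub_cutBoxDecomposition` (a.e. signed decomposition of a cut log-box into corner cells)

The line's `certifiedPairs` step consumes almost-everywhere signed decompositions
`1_{r.domain} = ∑ i, c_i · 1_{(ρ i).domain}`.  This file supplies the one for a log-box
`{∀ ι, a ι < x ι < b ι}` cut by one binomial wall `∏ x ι ^ m ι < c` (with the slack conditions
`0 < z`, `z · ∏ x ι < 1`): the weights are `(-1)^{#S}` over the `2ⁿ` corner cells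
`{∀ ι, e_S ι < x ι}` (`e_S ι = b ι` on `S`, `a ι` off `S`), `S ⊆ Fin n`.

Proof: the pointwise identity off the walls `x ι = b ι` is `stub_cornerCut`
(inclusion–exclusion of translated orthants, file `…CornerCut.lean`); the finitely many
coordinate hyperplanes `{x ι = b ι}` are Lebesgue-null (`Measure.ae_eval_ne`), so the identity
holds almost everywhere.  The integer weights `((-1 : ℤ) ^ #S : ℝ)` are `(-1 : ℝ) ^ #S`
(`push_cast`).

Sources: folklore (inclusion–exclusion of translated orthants; coordinate hyperplanes are null).
-/

noncomputable section

open MeasureTheory Set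
open Literature.NumberTheory.Transcendental

namespace Summit.KontsevichZagierPeriods.SymplecticScissors.LogPolytope

/-- Almost every point of `ℝⁿ⁺¹` lies off the finitely many coordinate hyperplanes
`{x (castSucc ι) = b ι}`, `ι : Fin n` (each is Lebesgue-null). [folklore] -/
theorem cbd_ae_castSucc_ne {n : ℕ} (b : Fin n → ℝ) :
    ∀ᵐ x : Fin (n + 1) → ℝ, ∀ ι : Fin n, x (Fin.castSucc ι) ≠ b ι := by
  rw [ae_all_iff]
  intro ι
  rw [volume_pi]
  exact Measure.ae_eval_ne _ _ _

/-- **Stub (cut box = signed sum of its corner cells, a.e.).** For a log-box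
`{∀ ι, a ι < x ι < b ι}` (`a ι ≤ b ι`) cut by one binomial wall `∏ x ι ^ m ι < c`, with the slack
conditions `0 < z`, `z · ∏ x ι < 1`, the indicator of the cut box equals almost everywhere the
alternating sum `∑_S (-1)^{#S} 1_{corner S}` over `S ⊆ Fin n` of the indicators of the corner
cells `{∀ ι, e_S ι < x ι}` (`e_S = b` on `S`, `a` off `S`) with the same cut and slack: pointwise
off the null walls `{x ι = b ι}` this is `stub_cornerCut`. [folklore] -/
theorem stub_cutBoxDecomposition : ∀ (n : ℕ) (a b : Fin n → ℝ) (m : Fin n → ℕ) (c : ℝ) (r : KZ.IntegralRep (n + 1))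
    (ρ : Finset (Fin n) → KZ.IntegralRep (n + 1)),
    (∀ ι, a ι ≤ b ι) →
    r.domain = {q : Fin (n + 1) → ℝ | (∀ ι : Fin n, a ι < q (Fin.castSucc ι) ∧ q (Fin.castSucc ι) < b ι) ∧
        ∏ ι : Fin n, q (Fin.castSucc ι) ^ (m ι) < c ∧ 0 < q (Fin.last n) ∧
        q (Fin.last n) * ∏ ι : Fin n, q (Fin.castSucc ι) < 1} →
    (∀ S : Finset (Fin n), (ρ S).domain = {q : Fin (n + 1) → ℝ | (∀ ι : Fin n, (if ι ∈ S then b ι else a ι) < q (Fin.castSucc ι)) ∧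
          ∏ ι : Fin n, q (Fin.castSucc ι) ^ (m ι) < c ∧ 0 < q (Fin.last n) ∧
          q (Fin.last n) * ∏ ι : Fin n, q (Fin.castSucc ι) < 1}) →
    ∀ᵐ x : Fin (n + 1) → ℝ, r.domain.indicator (fun _ => (1 : ℝ)) x =
      ∑ S : Finset (Fin n), (((-1 : ℤ) ^ S.card : ℤ) : ℝ) * (ρ S).domain.indicator (fun _ => (1 : ℝ)) x := by
  intro n a b m c r ρ hab hr hρ
  filter_upwards [cbd_ae_castSucc_ne b] with x hx
  rw [hr]
  simp only [hρ]
  rw [stub_cornerCut n a b m c x hab hx]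
  push_cast
  rfl

end Summit.KontsevichZagierPeriods.SymplecticScissors.LogPolytope

end
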